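import Summits.QuantumFields.BalabanUV.Beta.FP.LevelZeroDoorShapes

/-!
# `BalabanUV.Beta.FP.LevelZeroDoorSocket` — road «FP» for binder row D1, ROUTE T, memo `N2B-DESIGN.md` (31d)∕(32e)∕(33e) STEP 1 **CONCRETE**, FILE 2∕2:
# «THE LEVEL-0 DOOR AS ONE HYPOTHESIS» — U21's JET SHAPES (with the (Δ1) companion slots and the (Δ5) free order-2 slots) ARE A DIRECTIONAL DOOR, HENCE
# #20 §5's THREE TORUS KERNELS ON THE TOP BONDS (RULING R-FP-63 STATUS [D1P3-G25-RFP63]: the order-2 AVERAGING bindings enter as DISPLAYED bilinear maps)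

WHY.  #33 `DirectionalDoorKernelLaw.mixedVar_kernel_law_of_directional_door` is STEP 1 of the level-0 assembly in ABSTRACT form: three graded bordered systems
whose jets are functions of a direction with ONE linearity hypothesis per slot.  THIS FILE discharges those hypotheses for the CONCRETE jet shapes of the
level-0 door (leaf-02's U21 `…LevelZeroSymULowClosedLamW2Q2` ∕ the candidate U23♭ — conclusion VERBATIM the same) and packages the result as a SOCKET: a
theorem whose ONE door hypothesis `hdoor` is the U-file's conclusion read as a function of the direction `v ∈ V` (an abstract real module read through two
displayed LINEAR maps `hv : V → (β → ℝ)` — the fine direction `h` — and `lv : V → (γ → ℝ)` — the gauge parameter `λ`; at the assembly `V` = the top-level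
directions, `hv` = the nested column #29, `lv` = the tree-gauge parameter) and of the free order-2 element `E`, and whose conclusion is #33's three-kernel
identity for every finite direction family `d : σ → V` and every symmetric free family `E`.  When the U-file lands, the assembly's STEP 1 is ONE adapter:
instantiate the jet functions by the U-file's defining expressions (`rfl`), the displayed slots by the dictionary's companions ∕ bindings, and discharge
`hdoor` by `exact` of the U-file's theorem with its rows.

WHAT IS CONCRETE (linearity PROVED, via FILE 1∕2 `LevelZeroDoorShapes` + #33 §4 + #34): every binding the record has FIXED, over ABSTRACT table families —
F-side `H₁` (`hH₁`: `a • Σ_b h_b • TW b + Σ_b h_b • (w • TΛ b)`, U21's Wilson + Λ halves), `Q₁₁` (`hQ₁₁`), `H₂` (`hH₂`: `a² • ΣΣ (h_b h′_{b′}) • TWW b b′`),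
`Q₁₂` (`hQ₁₂`); N-side `H′₁` (`hH′₁`: the same along the GAUGE-SHIFTED weight `h_b + Σ_s D b s·λ_s`), `𝔔′₁` (`h𝔔′₁`: `Q₂₁(h′)·Q₁₀ + Q₂₀·Q₁₁(h′)`), `H′₂`
(`hH′₂`: bi-member along `h′ ⊗ h′` + the one-shot commutator `a • (L(h)·E_{λ′} − E_λ·L(h′))`, POLARISED); G-side the two DRESSED WORDS of #32 (`hGw₁`, `hGw₂` =
the polarised `W₂♭`), `Q₂₁` (`hQ₂₁`); the door hypothesis carries the UN-SPLIT order-2 word with the free fine element `ΦF E` INSIDE its `H₂` slot (as the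
U-file states it) — `word_add_form` takes it out as `(L·(ΦF E)·I)₁₁`.  WHAT IS DISPLAYED (abstract maps with (bi)linearity hypotheses): the (Δ1) order-1
companions `ΛN ΛG`, order-2 companions `N₂c G₂c`, the order-2 AVERAGING bindings `NY₂` (the one-shot naming `𝔔′₂`) and `GY₂` (`Q₂₂`) — under adjudication
(R-FP-63 (iv) ∕ an2 R-D1-g44-3: PART THREE's junction decides the presentation; U21's two-summand and U23♭'s one-summand shapes both instantiate by
`bilin_sum_sum_smul_*` one-liners) —, the free-slot maps `ΦN ΦF : W → Matrix β β ℝ`, `ΨG : W → Matrix βc βc ℝ` on an abstract module `W` with admissibility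
`P`.  [folklore] finite (bi)linear algebra; no `def`, no `def … : Prop`, nothing cited, 0 sorry.

HONEST DEPENDENCY (page 1, mandatory): continuum YM on T⁴ ⇐ BetaPertH ∧ nine spine estimates (0/9 proved); BetaPertH ⇐ (D1) ∧ (D4) ∧ CAP+tail;
G-an2-4 gates asym, D1 and NE2/3/4.  HONEST FRAMING (cell contract, verbatim): «discharging `BetaPertH` makes Bałaban's UV stability UNCONDITIONAL —
a real constructive-QFT result; it is NOT the continuum limit and NOT the Clay problem.»  ABSOLUTE RULE (cell charter, verbatim): «No internally-minted
statement may enter as a cited fact. Every hypothesis is either kernel-proved in this package or a verbatim quotation of a PUBLISHED theorem with page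
reference. The manuscript(s) under audit are NOT citable for their own disputed steps — they are the thing under adjudication; programme-internal
(2001/route/tribunal) claims are never citable.»  The door is a HYPOTHESIS here (nothing of leaf-02's ∕ the dictionary's asserted); 0 estimates; 0∕4 row-D1
binders (hW, hR, D1Tel, D1Rep); NOT (T-ID), NOT SDF, NOT D1, NOT BetaPertH, NOT continuum, NOT Clay.  Road «FP» OWNER, b2b-balaban-beta-d1-p3 gen 25,
2026-08-23.  No existing file touched.
-/

noncomputable section

open scoped BigOperators Matrix

namespace Summit.QuantumFields.BalabanUV.Beta.FP.LevelZeroDoorSocket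

open Matrix
open Literature.MathematicalPhysics.QuantumFieldTheory.Balaban1983to89.Beta.Composition (kkt)
open Summit.QuantumFields.BalabanUV.Beta.D1BFx.LogDetSecondVariation (secondVar)
open Summit.QuantumFields.BalabanUV.Beta.FP.SecondVarPolarisation (mixedVar)
open Summit.QuantumFields.BalabanUV.Beta.FP.DirectionalDoorKernelLaw (mixedVar_kernel_law_of_directional_door lin_sum_smul bilin_sum_sum_smul_left
  bilin_sum_sum_smul_right lin_add)
open Summit.QuantumFields.BalabanUV.Beta.FP.DirectionalJetShapes (lin_diagonal_fun)
open Summit.QuantumFields.BalabanUV.Beta.FP.LevelZeroDoorShapes (fromRows_zero_lin toBlocks₁₁_add' toBlocks₁₁_lin orderOne_word_lin word_add_form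
  orderTwo_word_lin_left orderTwo_word_lin_right)

/-! ## THE SOCKET: the level-0 door in U21's shape, as ONE hypothesis, gives the three torus kernels -/

section Socket

variable {V W : Type*} [AddCommGroup V] [Module ℝ V] [AddCommGroup W] [Module ℝ W]
variable {β γ βc κ σ ρ₁ ρ₂ ρ₃ : Type*} [Fintype β] [DecidableEq β] [Fintype γ] [Fintype βc] [DecidableEq βc] [Fintype κ] [DecidableEq κ]
  [Fintype σ] [DecidableEq σ] [Fintype ρ₁] [DecidableEq ρ₁] [Fintype ρ₂] [DecidableEq ρ₂] [Fintype ρ₃] [DecidableEq ρ₃]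

/-- [folklore] **THE LEVEL-0 DOOR SOCKET** (memo (32e) STEP 1, CONCRETE).  Directions `v ∈ V` (an abstract real module — at the assembly the top-level
directions; for U21 alone `V = (β → ℝ) × (γ → ℝ)`) read through two DISPLAYED linear maps `hv : V → (β → ℝ)` (the fine direction `h`) and
`lv : V → (γ → ℝ)` (the gauge parameter `λ`); the level-0 door's jets as FUNCTIONS of `v` by their defining equations in U21's shapes over abstract table
families (`hQ₁₁ hQ₂₁ hQ₁₂ hH₁ hH′₁ hH₂ hH′₂ h𝔔′₁ hGw₁ hGw₂` — `β` fine bonds, `γ` fine sites, `βc` coarse bonds, `κ` top bonds ∕ one-shot multipliers,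
`ρ₁ ρ₂ ρ₃` the residual parameter types of the three systems; `a = (−2)·c₀`, `w` the Λ weight, `q = −c₀`, `D` = `tgrad`'s fine block, `pr` = `Prod.fst`,
`TW TΛ TWW TQ TQ₂ TQQ` the periodised tables, `Q₁₀ Q₂₀ Γ I L S N₀ F₀ G₀` the direction-free structure); the (Δ1) order-1 companions `ΛN ΛG`, order-2
companions `N₂c G₂c`, the order-2 AVERAGING bindings `NY₂` (`𝔔′₂`) and `GY₂` (`Q₂₂`) and the free-slot maps `ΦN ΦF ΨG` on `W` with admissibility `P`
DISPLAYED with their (bi)linearity; **`hdoor`** = the door's conclusion for every direction `v` and admissible `E` EXACTLY as the U-file states it (the free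
fine element `ΦF E` INSIDE the G-side order-2 word's `H₂` slot).  THEN for every finite family `d : σ → V`, every `(k,l)`-symmetric free family `E` with
admissible packings, every pair `(k, l)`: #33's three-kernel identity `mixedVar N₀ … = mixedVar F₀ … + mixedVar G₀ …` with the SYMMETRISED second jets,
the G-side free slot split as `(L·(ΦF (E k l))·I)₁₁ + ΨG (E k l)`.  Proof: per-jet linearity (§1–§3, #32, #33 §4, #34) + `word_add_form` + ONE call of
`mixedVar_kernel_law_of_directional_door`. -/
theorem mixedVar_kernel_law_of_levelZero_door
    -- the direction read-outs
    (hv : V → β → ℝ) (lv : V → γ → ℝ)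
    (hhv : ∀ (c : ℝ) (x y : V), hv (c • x + y) = c • hv x + hv y) (hlv : ∀ (c : ℝ) (x y : V), lv (c • x + y) = c • lv x + lv y)
    -- scalars, the gauge shift, the site projection, the table families, the direction-free structure
    (a w q : ℝ) (D : β → γ → ℝ) (pr : β → γ)
    (TW TΛ : β → Matrix β β ℝ) (TWW : β → β → Matrix β β ℝ) (TQ : β → Matrix βc β ℝ) (TQ₂ : β → Matrix κ βc ℝ) (TQQ : β → β → Matrix βc β ℝ)
    (Q₁₀ : Matrix βc β ℝ) (Q₂₀ : Matrix κ βc ℝ)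
    (Γ : Matrix β β ℝ) (I : Matrix β (βc ⊕ ρ₂) ℝ) (L : Matrix (βc ⊕ ρ₂) β ℝ) (S : Matrix (βc ⊕ ρ₂) (βc ⊕ ρ₂) ℝ)
    (N₀ : Matrix (β ⊕ (κ ⊕ ρ₁)) (β ⊕ (κ ⊕ ρ₁)) ℝ) (F₀ : Matrix (β ⊕ (βc ⊕ ρ₂)) (β ⊕ (βc ⊕ ρ₂)) ℝ) (G₀ : Matrix (βc ⊕ (κ ⊕ ρ₃)) (βc ⊕ (κ ⊕ ρ₃)) ℝ)
    -- the averaging jets by their defining equations (U21's `hQ₁₁ hQ₂₁ hQ₁₂` shapes)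
    (Q₁₁ : (β → ℝ) → Matrix βc β ℝ) (hQ₁₁ : ∀ x, Q₁₁ x = ∑ b, x b • TQ b)
    (Q₂₁ : (β → ℝ) → Matrix κ βc ℝ) (hQ₂₁ : ∀ x, Q₂₁ x = ∑ b, x b • TQ₂ b)
    (Q₁₂ : (β → ℝ) → (β → ℝ) → Matrix βc β ℝ) (hQ₁₂ : ∀ x y, Q₁₂ x y = q • ∑ b, ∑ b', (x b * y b') • TQQ b b')
    -- the form jets by their defining equations (U21's `hH₁ hH′₁ hH₂ hH′₂` shapes — `G` ∕ `E` taken OUT of `hH₂ hH′₂`, it enters through `ΦF ΦN`)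
    (H₁ : V → Matrix β β ℝ) (hH₁ : ∀ v, H₁ v = a • (∑ b, hv v b • TW b) + ∑ b, hv v b • (w • TΛ b))
    (H'₁ : V → Matrix β β ℝ)
    (hH'₁ : ∀ v, H'₁ v = a • (∑ b, (hv v b + ∑ s, D b s * lv v s) • TW b) + ∑ b, (hv v b + ∑ s, D b s * lv v s) • (w • TΛ b))
    (H₂ : V → V → Matrix β β ℝ) (hH₂ : ∀ v v', H₂ v v' = a ^ 2 • ∑ b, ∑ b', (hv v b * hv v' b') • TWW b b')
    (H'₂ : V → V → Matrix β β ℝ)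
    (hH'₂ : ∀ v v', H'₂ v v' = a ^ 2 • (∑ b, ∑ b', ((hv v b + ∑ s, D b s * lv v s) * (hv v' b' + ∑ s, D b' s * lv v' s)) • TWW b b')
      + a • ((∑ b, hv v b • (w • TΛ b)) * Matrix.diagonal (fun b => lv v' (pr b))
            - Matrix.diagonal (fun b => lv v (pr b)) * (∑ b, hv v' b • (w • TΛ b))))
    -- the one-shot first composite averaging jet, NAMED (U21's `h𝔔′₁`)
    (𝔔'₁ : V → Matrix κ β ℝ)
    (h𝔔'₁ : ∀ v, 𝔔'₁ v = Q₂₁ (fun b => hv v b + ∑ s, D b s * lv v s) * Q₁₀ + Q₂₀ * Q₁₁ (fun b => hv v b + ∑ s, D b s * lv v s))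
    -- the G-side DRESSED WORDS (#32): order 1, and the POLARISED order-2 word at the PURE second form jet
    (Gw₁ : V → Matrix βc βc ℝ)
    (hGw₁ : ∀ v, Gw₁ v = ((L * (H₁ v) - S * (fromRows (Q₁₁ (hv v)) (0 : Matrix ρ₂ β ℝ))) * I + L * (fromRows (Q₁₁ (hv v)) (0 : Matrix ρ₂ β ℝ))ᵀ * S).toBlocks₁₁)
    (Gw₂ : V → V → Matrix βc βc ℝ)
    (hGw₂ : ∀ v v', Gw₂ v v' =
      ((((-((L * (H₁ v) - S * (fromRows (Q₁₁ (hv v)) (0 : Matrix ρ₂ β ℝ))) * Γ - L * (fromRows (Q₁₁ (hv v)) (0 : Matrix ρ₂ β ℝ))ᵀ * L) * (H₁ v') + L * (H₂ v v')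
          - (((L * (H₁ v) - S * (fromRows (Q₁₁ (hv v)) (0 : Matrix ρ₂ β ℝ))) * I + L * (fromRows (Q₁₁ (hv v)) (0 : Matrix ρ₂ β ℝ))ᵀ * S) * (fromRows (Q₁₁ (hv v')) (0 : Matrix ρ₂ β ℝ)) + S * (fromRows (Q₁₂ (hv v) (hv v')) (0 : Matrix ρ₂ β ℝ)))) * I
        + (L * (H₁ v) - S * (fromRows (Q₁₁ (hv v)) (0 : Matrix ρ₂ β ℝ))) * (-((Γ * (H₁ v') + I * (fromRows (Q₁₁ (hv v')) (0 : Matrix ρ₂ β ℝ))) * I + Γ * (fromRows (Q₁₁ (hv v')) (0 : Matrix ρ₂ β ℝ))ᵀ * S)))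
      - ((-((L * (H₁ v) - S * (fromRows (Q₁₁ (hv v)) (0 : Matrix ρ₂ β ℝ))) * Γ - L * (fromRows (Q₁₁ (hv v)) (0 : Matrix ρ₂ β ℝ))ᵀ * L) * (-(fromRows (Q₁₁ (hv v')) (0 : Matrix ρ₂ β ℝ))ᵀ) + L * (fromRows (Q₁₂ (hv v) (hv v')) (0 : Matrix ρ₂ β ℝ))ᵀ) * S
          + L * (-(fromRows (Q₁₁ (hv v)) (0 : Matrix ρ₂ β ℝ))ᵀ) * ((L * (H₁ v') - S * (fromRows (Q₁₁ (hv v')) (0 : Matrix ρ₂ β ℝ))) * I + L * (fromRows (Q₁₁ (hv v')) (0 : Matrix ρ₂ β ℝ))ᵀ * S)))).toBlocks₁₁)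
    -- DISPLAYED: the (Δ1) order-1 companions, the order-2 companions, the order-2 AVERAGING bindings (R-FP-63 (iv)), the free-slot maps
    (ΛN : V → Matrix β β ℝ) (hΛN : ∀ (c : ℝ) (x y : V), ΛN (c • x + y) = c • ΛN x + ΛN y)
    (ΛG : V → Matrix βc βc ℝ) (hΛG : ∀ (c : ℝ) (x y : V), ΛG (c • x + y) = c • ΛG x + ΛG y)
    (N₂c : V → V → Matrix β β ℝ)
    (hN₂cl : ∀ (c : ℝ) (x y z : V), N₂c (c • x + y) z = c • N₂c x z + N₂c y z) (hN₂cr : ∀ (c : ℝ) (x y z : V), N₂c x (c • y + z) = c • N₂c x y + N₂c x z)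
    (G₂c : V → V → Matrix βc βc ℝ)
    (hG₂cl : ∀ (c : ℝ) (x y z : V), G₂c (c • x + y) z = c • G₂c x z + G₂c y z) (hG₂cr : ∀ (c : ℝ) (x y z : V), G₂c x (c • y + z) = c • G₂c x y + G₂c x z)
    (NY₂ : V → V → Matrix κ β ℝ)
    (hNY₂l : ∀ (c : ℝ) (x y z : V), NY₂ (c • x + y) z = c • NY₂ x z + NY₂ y z) (hNY₂r : ∀ (c : ℝ) (x y z : V), NY₂ x (c • y + z) = c • NY₂ x y + NY₂ x z)
    (GY₂ : V → V → Matrix κ βc ℝ)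
    (hGY₂l : ∀ (c : ℝ) (x y z : V), GY₂ (c • x + y) z = c • GY₂ x z + GY₂ y z) (hGY₂r : ∀ (c : ℝ) (x y z : V), GY₂ x (c • y + z) = c • GY₂ x y + GY₂ x z)
    (ΦN ΦF : W → Matrix β β ℝ) (ΨG : W → Matrix βc βc ℝ)
    (hΦN : ∀ (c : ℝ) (x y : W), ΦN (c • x + y) = c • ΦN x + ΦN y) (hΦF : ∀ (c : ℝ) (x y : W), ΦF (c • x + y) = c • ΦF x + ΦF y)
    (hΨG : ∀ (c : ℝ) (x y : W), ΨG (c • x + y) = c • ΨG x + ΨG y)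
    (P : W → Prop)
    -- THE DOOR, for every direction and every admissible free element, AS THE U-FILE STATES IT
    (hdoor : ∀ (v : V) (e : W), P e →
      secondVar N₀
          (fromBlocks (H'₁ v + ΛN v) (-(fromRows (𝔔'₁ v) (0 : Matrix ρ₁ β ℝ))ᵀ) (fromRows (𝔔'₁ v) (0 : Matrix ρ₁ β ℝ)) 0)
          (kkt (H'₂ v v + N₂c v v + ΦN e) (fromRows (NY₂ v v) (0 : Matrix ρ₁ β ℝ)))
        = secondVar F₀
            (fromBlocks (H₁ v) (-(fromRows (Q₁₁ (hv v)) (0 : Matrix ρ₂ β ℝ))ᵀ) (fromRows (Q₁₁ (hv v)) (0 : Matrix ρ₂ β ℝ)) 0)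
            (kkt (H₂ v v + ΦF e) (fromRows (Q₁₂ (hv v) (hv v)) (0 : Matrix ρ₂ β ℝ)))
          + secondVar G₀
            (fromBlocks (Gw₁ v + ΛG v) (-(fromRows (Q₂₁ (hv v)) (0 : Matrix ρ₃ βc ℝ))ᵀ) (fromRows (Q₂₁ (hv v)) (0 : Matrix ρ₃ βc ℝ)) 0)
            (kkt (((((-((L * (H₁ v) - S * (fromRows (Q₁₁ (hv v)) (0 : Matrix ρ₂ β ℝ))) * Γ - L * (fromRows (Q₁₁ (hv v)) (0 : Matrix ρ₂ β ℝ))ᵀ * L) * (H₁ v) + L * (H₂ v v + ΦF e)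
          - (((L * (H₁ v) - S * (fromRows (Q₁₁ (hv v)) (0 : Matrix ρ₂ β ℝ))) * I + L * (fromRows (Q₁₁ (hv v)) (0 : Matrix ρ₂ β ℝ))ᵀ * S) * (fromRows (Q₁₁ (hv v)) (0 : Matrix ρ₂ β ℝ)) + S * (fromRows (Q₁₂ (hv v) (hv v)) (0 : Matrix ρ₂ β ℝ)))) * I
        + (L * (H₁ v) - S * (fromRows (Q₁₁ (hv v)) (0 : Matrix ρ₂ β ℝ))) * (-((Γ * (H₁ v) + I * (fromRows (Q₁₁ (hv v)) (0 : Matrix ρ₂ β ℝ))) * I + Γ * (fromRows (Q₁₁ (hv v)) (0 : Matrix ρ₂ β ℝ))ᵀ * S)))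
      - ((-((L * (H₁ v) - S * (fromRows (Q₁₁ (hv v)) (0 : Matrix ρ₂ β ℝ))) * Γ - L * (fromRows (Q₁₁ (hv v)) (0 : Matrix ρ₂ β ℝ))ᵀ * L) * (-(fromRows (Q₁₁ (hv v)) (0 : Matrix ρ₂ β ℝ))ᵀ) + L * (fromRows (Q₁₂ (hv v) (hv v)) (0 : Matrix ρ₂ β ℝ))ᵀ) * S
          + L * (-(fromRows (Q₁₁ (hv v)) (0 : Matrix ρ₂ β ℝ))ᵀ) * ((L * (H₁ v) - S * (fromRows (Q₁₁ (hv v)) (0 : Matrix ρ₂ β ℝ))) * I + L * (fromRows (Q₁₁ (hv v)) (0 : Matrix ρ₂ β ℝ))ᵀ * S)))).toBlocks₁₁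
                  + G₂c v v + ΨG e)
              (fromRows (GY₂ v v) (0 : Matrix ρ₃ βc ℝ))))
    -- a finite family of directions, a symmetric free family admissible at every packing, a pair of top bonds
    (d : σ → V) (E : σ → σ → W) (hEs : ∀ k l, E k l = E l k) (hP : ∀ r : σ → ℝ, P (∑ k, ∑ l, (r k * r l) • E k l)) (k l : σ) :
    mixedVar N₀
        (fromBlocks (H'₁ (d k) + ΛN (d k)) (-(fromRows (𝔔'₁ (d k)) (0 : Matrix ρ₁ β ℝ))ᵀ) (fromRows (𝔔'₁ (d k)) (0 : Matrix ρ₁ β ℝ)) 0)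
        (fromBlocks (H'₁ (d l) + ΛN (d l)) (-(fromRows (𝔔'₁ (d l)) (0 : Matrix ρ₁ β ℝ))ᵀ) (fromRows (𝔔'₁ (d l)) (0 : Matrix ρ₁ β ℝ)) 0)
        (kkt ((1 / 2 : ℝ) • ((H'₂ (d k) (d l) + N₂c (d k) (d l)) + (H'₂ (d l) (d k) + N₂c (d l) (d k))) + ΦN (E k l))
          (fromRows ((1 / 2 : ℝ) • (NY₂ (d k) (d l) + NY₂ (d l) (d k))) (0 : Matrix ρ₁ β ℝ)))
      = mixedVar F₀
          (fromBlocks (H₁ (d k)) (-(fromRows (Q₁₁ (hv (d k))) (0 : Matrix ρ₂ β ℝ))ᵀ) (fromRows (Q₁₁ (hv (d k))) (0 : Matrix ρ₂ β ℝ)) 0)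
          (fromBlocks (H₁ (d l)) (-(fromRows (Q₁₁ (hv (d l))) (0 : Matrix ρ₂ β ℝ))ᵀ) (fromRows (Q₁₁ (hv (d l))) (0 : Matrix ρ₂ β ℝ)) 0)
          (kkt ((1 / 2 : ℝ) • (H₂ (d k) (d l) + H₂ (d l) (d k)) + ΦF (E k l))
            (fromRows ((1 / 2 : ℝ) • (Q₁₂ (hv (d k)) (hv (d l)) + Q₁₂ (hv (d l)) (hv (d k)))) (0 : Matrix ρ₂ β ℝ)))
        + mixedVar G₀
          (fromBlocks (Gw₁ (d k) + ΛG (d k)) (-(fromRows (Q₂₁ (hv (d k))) (0 : Matrix ρ₃ βc ℝ))ᵀ) (fromRows (Q₂₁ (hv (d k))) (0 : Matrix ρ₃ βc ℝ)) 0)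
          (fromBlocks (Gw₁ (d l) + ΛG (d l)) (-(fromRows (Q₂₁ (hv (d l))) (0 : Matrix ρ₃ βc ℝ))ᵀ) (fromRows (Q₂₁ (hv (d l))) (0 : Matrix ρ₃ βc ℝ)) 0)
          (kkt ((1 / 2 : ℝ) • ((Gw₂ (d k) (d l) + G₂c (d k) (d l)) + (Gw₂ (d l) (d k) + G₂c (d l) (d k)))
                + ((L * ΦF (E k l) * I).toBlocks₁₁ + ΨG (E k l)))
            (fromRows ((1 / 2 : ℝ) • (GY₂ (d k) (d l) + GY₂ (d l) (d k))) (0 : Matrix ρ₃ βc ℝ))) := by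
  -- (0) the gauge-shifted weight is a LINEAR read-out
  have hsh : ∀ (c : ℝ) (x y : V),
      (fun b => hv (c • x + y) b + ∑ s, D b s * lv (c • x + y) s)
        = c • (fun b => hv x b + ∑ s, D b s * lv x s) + (fun b => hv y b + ∑ s, D b s * lv y s) := by
    intro c x y
    funext b
    simp only [hhv, hlv, Pi.add_apply, Pi.smul_apply, smul_eq_mul]
    rw [show (∑ s, D b s * (c * lv x s + lv y s)) = c * (∑ s, D b s * lv x s) + ∑ s, D b s * lv y s by
      rw [Finset.mul_sum, ← Finset.sum_add_distrib]; exact Finset.sum_congr rfl fun _ _ => by ring]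
    ring
  -- (1) the averaging jets are linear in the weight, hence in the direction (plain and shifted)
  have hQ₁₁w : ∀ (c : ℝ) (x y : β → ℝ), Q₁₁ (c • x + y) = c • Q₁₁ x + Q₁₁ y := fun c x y => by
    rw [hQ₁₁, hQ₁₁, hQ₁₁]; exact lin_sum_smul TQ c x y
  have hQ₂₁w : ∀ (c : ℝ) (x y : β → ℝ), Q₂₁ (c • x + y) = c • Q₂₁ x + Q₂₁ y := fun c x y => by
    rw [hQ₂₁, hQ₂₁, hQ₂₁]; exact lin_sum_smul TQ₂ c x y
  have hQ₁₁v : ∀ (c : ℝ) (x y : V), Q₁₁ (hv (c • x + y)) = c • Q₁₁ (hv x) + Q₁₁ (hv y) := fun c x y => by rw [hhv, hQ₁₁w]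
  have hQ₂₁v : ∀ (c : ℝ) (x y : V), Q₂₁ (hv (c • x + y)) = c • Q₂₁ (hv x) + Q₂₁ (hv y) := fun c x y => by rw [hhv, hQ₂₁w]
  have hQ₁₁s : ∀ (c : ℝ) (x y : V), Q₁₁ (fun b => hv (c • x + y) b + ∑ s, D b s * lv (c • x + y) s)
      = c • Q₁₁ (fun b => hv x b + ∑ s, D b s * lv x s) + Q₁₁ (fun b => hv y b + ∑ s, D b s * lv y s) := fun c x y => by
    rw [hsh, hQ₁₁w]
  have hQ₂₁s : ∀ (c : ℝ) (x y : V), Q₂₁ (fun b => hv (c • x + y) b + ∑ s, D b s * lv (c • x + y) s)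
      = c • Q₂₁ (fun b => hv x b + ∑ s, D b s * lv x s) + Q₂₁ (fun b => hv y b + ∑ s, D b s * lv y s) := fun c x y => by
    rw [hsh, hQ₂₁w]
  have hQ₁₂l : ∀ (c : ℝ) (x y z : V), Q₁₂ (hv (c • x + y)) (hv z) = c • Q₁₂ (hv x) (hv z) + Q₁₂ (hv y) (hv z) := fun c x y z => by
    rw [hQ₁₂, hQ₁₂, hQ₁₂, hhv, bilin_sum_sum_smul_left, smul_add, smul_comm q c]
  have hQ₁₂r : ∀ (c : ℝ) (x y z : V), Q₁₂ (hv z) (hv (c • x + y)) = c • Q₁₂ (hv z) (hv x) + Q₁₂ (hv z) (hv y) := fun c x y z => by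
    rw [hQ₁₂, hQ₁₂, hQ₁₂, hhv, bilin_sum_sum_smul_right, smul_add, smul_comm q c]
  have hBv : ∀ (c : ℝ) (x y : V), fromRows (Q₁₁ (hv (c • x + y))) (0 : Matrix ρ₂ β ℝ)
      = c • fromRows (Q₁₁ (hv x)) (0 : Matrix ρ₂ β ℝ) + fromRows (Q₁₁ (hv y)) (0 : Matrix ρ₂ β ℝ) := fun c x y => by
    rw [hQ₁₁v, fromRows_zero_lin]
  have hBql : ∀ (c : ℝ) (x y z : V), fromRows (Q₁₂ (hv (c • x + y)) (hv z)) (0 : Matrix ρ₂ β ℝ)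
      = c • fromRows (Q₁₂ (hv x) (hv z)) (0 : Matrix ρ₂ β ℝ) + fromRows (Q₁₂ (hv y) (hv z)) (0 : Matrix ρ₂ β ℝ) := fun c x y z => by
    rw [hQ₁₂l, fromRows_zero_lin]
  have hBqr : ∀ (c : ℝ) (x y z : V), fromRows (Q₁₂ (hv z) (hv (c • x + y))) (0 : Matrix ρ₂ β ℝ)
      = c • fromRows (Q₁₂ (hv z) (hv x)) (0 : Matrix ρ₂ β ℝ) + fromRows (Q₁₂ (hv z) (hv y)) (0 : Matrix ρ₂ β ℝ) := fun c x y z => by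
    rw [hQ₁₂r, fromRows_zero_lin]
  -- (2) the form jets
  have hW₁ : ∀ (c : ℝ) (x y : V), (∑ b, hv (c • x + y) b • TW b) = c • (∑ b, hv x b • TW b) + ∑ b, hv y b • TW b := fun c x y => by
    rw [hhv]; exact lin_sum_smul TW c (hv x) (hv y)
  have hL₁ : ∀ (c : ℝ) (x y : V), (∑ b, hv (c • x + y) b • (w • TΛ b)) = c • (∑ b, hv x b • (w • TΛ b)) + ∑ b, hv y b • (w • TΛ b) :=
    fun c x y => by rw [hhv]; exact lin_sum_smul (fun b => w • TΛ b) c (hv x) (hv y)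
  have hH₁l : ∀ (c : ℝ) (x y : V), H₁ (c • x + y) = c • H₁ x + H₁ y := fun c x y => by
    rw [hH₁, hH₁, hH₁, hW₁, hL₁, smul_add, smul_comm a c, smul_add]; abel
  have hshb : ∀ (c : ℝ) (x y : V) (b : β), hv (c • x + y) b + ∑ s, D b s * lv (c • x + y) s
      = c * (hv x b + ∑ s, D b s * lv x s) + (hv y b + ∑ s, D b s * lv y s) := fun c x y b => by
    have h := congrFun (hsh c x y) b
    simpa only [Pi.add_apply, Pi.smul_apply, smul_eq_mul] using h
  have hW₁s : ∀ (c : ℝ) (x y : V), (∑ b, (hv (c • x + y) b + ∑ s, D b s * lv (c • x + y) s) • TW b)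
      = c • (∑ b, (hv x b + ∑ s, D b s * lv x s) • TW b) + ∑ b, (hv y b + ∑ s, D b s * lv y s) • TW b := fun c x y => by
    have e : ∀ b, (hv (c • x + y) b + ∑ s, D b s * lv (c • x + y) s) • TW b
        = c • ((hv x b + ∑ s, D b s * lv x s) • TW b) + (hv y b + ∑ s, D b s * lv y s) • TW b := fun b => by
      rw [hshb, add_smul, mul_smul]
    simp only [e, Finset.sum_add_distrib, Finset.smul_sum]
  have hL₁s : ∀ (c : ℝ) (x y : V), (∑ b, (hv (c • x + y) b + ∑ s, D b s * lv (c • x + y) s) • (w • TΛ b))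
      = c • (∑ b, (hv x b + ∑ s, D b s * lv x s) • (w • TΛ b)) + ∑ b, (hv y b + ∑ s, D b s * lv y s) • (w • TΛ b) := fun c x y => by
    have e : ∀ b, (hv (c • x + y) b + ∑ s, D b s * lv (c • x + y) s) • (w • TΛ b)
        = c • ((hv x b + ∑ s, D b s * lv x s) • (w • TΛ b)) + (hv y b + ∑ s, D b s * lv y s) • (w • TΛ b) := fun b => by
      rw [hshb, add_smul, mul_smul]
    simp only [e, Finset.sum_add_distrib, Finset.smul_sum]
  have hH'₁l : ∀ (c : ℝ) (x y : V), H'₁ (c • x + y) = c • H'₁ x + H'₁ y := fun c x y => by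
    rw [hH'₁, hH'₁, hH'₁, hW₁s, hL₁s, smul_add, smul_comm a c, smul_add]; abel
  have hH₂l : ∀ (c : ℝ) (x y z : V), H₂ (c • x + y) z = c • H₂ x z + H₂ y z := fun c x y z => by
    rw [hH₂, hH₂, hH₂, hhv, bilin_sum_sum_smul_left, smul_add, smul_comm (a ^ 2) c]
  have hH₂r : ∀ (c : ℝ) (x y z : V), H₂ z (c • x + y) = c • H₂ z x + H₂ z y := fun c x y z => by
    rw [hH₂, hH₂, hH₂, hhv, bilin_sum_sum_smul_right, smul_add, smul_comm (a ^ 2) c]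
  -- the bi-member along shifted weights and the commutator
  have hB₂l : ∀ (c : ℝ) (x y z : V),
      (∑ b, ∑ b', ((hv (c • x + y) b + ∑ s, D b s * lv (c • x + y) s) * (hv z b' + ∑ s, D b' s * lv z s)) • TWW b b')
        = c • (∑ b, ∑ b', ((hv x b + ∑ s, D b s * lv x s) * (hv z b' + ∑ s, D b' s * lv z s)) • TWW b b')
          + ∑ b, ∑ b', ((hv y b + ∑ s, D b s * lv y s) * (hv z b' + ∑ s, D b' s * lv z s)) • TWW b b' := fun c x y z => by
    have e : ∀ b b', ((hv (c • x + y) b + ∑ s, D b s * lv (c • x + y) s) * (hv z b' + ∑ s, D b' s * lv z s)) • TWW b b'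
        = c • (((hv x b + ∑ s, D b s * lv x s) * (hv z b' + ∑ s, D b' s * lv z s)) • TWW b b')
          + ((hv y b + ∑ s, D b s * lv y s) * (hv z b' + ∑ s, D b' s * lv z s)) • TWW b b' := fun b b' => by
      rw [hshb, add_mul, add_smul, mul_assoc, mul_smul]
    simp only [e, Finset.sum_add_distrib, Finset.smul_sum]
  have hB₂r : ∀ (c : ℝ) (x y z : V),
      (∑ b, ∑ b', ((hv z b + ∑ s, D b s * lv z s) * (hv (c • x + y) b' + ∑ s, D b' s * lv (c • x + y) s)) • TWW b b')
        = c • (∑ b, ∑ b', ((hv z b + ∑ s, D b s * lv z s) * (hv x b' + ∑ s, D b' s * lv x s)) • TWW b b')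
          + ∑ b, ∑ b', ((hv z b + ∑ s, D b s * lv z s) * (hv y b' + ∑ s, D b' s * lv y s)) • TWW b b' := fun c x y z => by
    have e : ∀ b b', ((hv z b + ∑ s, D b s * lv z s) * (hv (c • x + y) b' + ∑ s, D b' s * lv (c • x + y) s)) • TWW b b'
        = c • (((hv z b + ∑ s, D b s * lv z s) * (hv x b' + ∑ s, D b' s * lv x s)) • TWW b b')
          + ((hv z b + ∑ s, D b s * lv z s) * (hv y b' + ∑ s, D b' s * lv y s)) • TWW b b' := fun b b' => by
      rw [hshb, mul_add, add_smul, mul_left_comm, mul_smul]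
    simp only [e, Finset.sum_add_distrib, Finset.smul_sum]
  have hDg : ∀ (c : ℝ) (x y : V), Matrix.diagonal (fun b => lv (c • x + y) (pr b))
      = c • Matrix.diagonal (fun b => lv x (pr b)) + Matrix.diagonal (fun b => lv y (pr b)) := fun c x y =>
    lin_diagonal_fun (fun (v : V) (b : β) => lv v (pr b)) (fun c x y => by funext b; simp only [hlv, Pi.add_apply, Pi.smul_apply]) c x y
  have hCl : ∀ (c : ℝ) (x y z : V),
      (∑ b, hv (c • x + y) b • (w • TΛ b)) * Matrix.diagonal (fun b => lv z (pr b))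
          - Matrix.diagonal (fun b => lv (c • x + y) (pr b)) * (∑ b, hv z b • (w • TΛ b))
        = c • ((∑ b, hv x b • (w • TΛ b)) * Matrix.diagonal (fun b => lv z (pr b)) - Matrix.diagonal (fun b => lv x (pr b)) * (∑ b, hv z b • (w • TΛ b)))
          + ((∑ b, hv y b • (w • TΛ b)) * Matrix.diagonal (fun b => lv z (pr b)) - Matrix.diagonal (fun b => lv y (pr b)) * (∑ b, hv z b • (w • TΛ b))) :=
    fun c x y z => by rw [hL₁, hDg, Matrix.add_mul, Matrix.smul_mul, Matrix.add_mul, Matrix.smul_mul, smul_sub]; abel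
  have hCr : ∀ (c : ℝ) (x y z : V),
      (∑ b, hv z b • (w • TΛ b)) * Matrix.diagonal (fun b => lv (c • x + y) (pr b))
          - Matrix.diagonal (fun b => lv z (pr b)) * (∑ b, hv (c • x + y) b • (w • TΛ b))
        = c • ((∑ b, hv z b • (w • TΛ b)) * Matrix.diagonal (fun b => lv x (pr b)) - Matrix.diagonal (fun b => lv z (pr b)) * (∑ b, hv x b • (w • TΛ b)))
          + ((∑ b, hv z b • (w • TΛ b)) * Matrix.diagonal (fun b => lv y (pr b)) - Matrix.diagonal (fun b => lv z (pr b)) * (∑ b, hv y b • (w • TΛ b))) :=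
    fun c x y z => by rw [hL₁, hDg, Matrix.mul_add, Matrix.mul_smul, Matrix.mul_add, Matrix.mul_smul, smul_sub]; abel
  have hH'₂l : ∀ (c : ℝ) (x y z : V), H'₂ (c • x + y) z = c • H'₂ x z + H'₂ y z := fun c x y z => by
    rw [hH'₂, hH'₂, hH'₂, hB₂l, hCl, smul_add, smul_comm (a ^ 2) c, smul_add, smul_comm a c, smul_add]; abel
  have hH'₂r : ∀ (c : ℝ) (x y z : V), H'₂ z (c • x + y) = c • H'₂ z x + H'₂ z y := fun c x y z => by
    rw [hH'₂, hH'₂, hH'₂, hB₂r, hCr, smul_add, smul_comm (a ^ 2) c, smul_add, smul_comm a c, smul_add]; abel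
  -- (3) the one-shot first averaging jet
  have h𝔔'₁l : ∀ (c : ℝ) (x y : V), 𝔔'₁ (c • x + y) = c • 𝔔'₁ x + 𝔔'₁ y := fun c x y => by
    rw [h𝔔'₁, h𝔔'₁, h𝔔'₁, hQ₂₁s, hQ₁₁s, Matrix.add_mul, Matrix.smul_mul, Matrix.mul_add, Matrix.mul_smul, smul_add]; abel
  -- (4) the dressed words
  have hGw₁l : ∀ (c : ℝ) (x y : V), Gw₁ (c • x + y) = c • Gw₁ x + Gw₁ y := fun c x y => by
    rw [hGw₁, hGw₁, hGw₁, ← toBlocks₁₁_lin]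
    exact congrArg Matrix.toBlocks₁₁
      (orderOne_word_lin I L S H₁ (fun v => fromRows (Q₁₁ (hv v)) (0 : Matrix ρ₂ β ℝ)) hH₁l hBv c x y)
  have hGw₂l : ∀ (c : ℝ) (x y z : V), Gw₂ (c • x + y) z = c • Gw₂ x z + Gw₂ y z := fun c x y z => by
    rw [hGw₂, hGw₂, hGw₂, ← toBlocks₁₁_lin]
    exact congrArg Matrix.toBlocks₁₁
      (orderTwo_word_lin_left Γ I L S H₁ (fun v => fromRows (Q₁₁ (hv v)) (0 : Matrix ρ₂ β ℝ)) H₂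
        (fun v v' => fromRows (Q₁₂ (hv v) (hv v')) (0 : Matrix ρ₂ β ℝ)) hH₁l hBv hH₂l hBql c x y z)
  have hGw₂r : ∀ (c : ℝ) (x y z : V), Gw₂ z (c • x + y) = c • Gw₂ z x + Gw₂ z y := fun c x y z => by
    rw [hGw₂, hGw₂, hGw₂, ← toBlocks₁₁_lin]
    exact congrArg Matrix.toBlocks₁₁
      (orderTwo_word_lin_right Γ I L S H₁ (fun v => fromRows (Q₁₁ (hv v)) (0 : Matrix ρ₂ β ℝ)) H₂
        (fun v v' => fromRows (Q₁₂ (hv v) (hv v')) (0 : Matrix ρ₂ β ℝ)) hH₁l hBv hH₂r hBqr c x y z)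
  -- (5) the door in #33's split form: the free fine element comes out of the G-side word as `L·(ΦF e)·I`
  have hdoor' : ∀ (v : V) (e : W), P e →
      secondVar N₀
          (fromBlocks (H'₁ v + ΛN v) (-(fromRows (𝔔'₁ v) (0 : Matrix ρ₁ β ℝ))ᵀ) (fromRows (𝔔'₁ v) (0 : Matrix ρ₁ β ℝ)) 0)
          (kkt (H'₂ v v + N₂c v v + ΦN e) (fromRows (NY₂ v v) (0 : Matrix ρ₁ β ℝ)))
        = secondVar F₀
            (fromBlocks (H₁ v) (-(fromRows (Q₁₁ (hv v)) (0 : Matrix ρ₂ β ℝ))ᵀ) (fromRows (Q₁₁ (hv v)) (0 : Matrix ρ₂ β ℝ)) 0)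
            (kkt (H₂ v v + ΦF e) (fromRows (Q₁₂ (hv v) (hv v)) (0 : Matrix ρ₂ β ℝ)))
          + secondVar G₀
            (fromBlocks (Gw₁ v + ΛG v) (-(fromRows (Q₂₁ (hv v)) (0 : Matrix ρ₃ βc ℝ))ᵀ) (fromRows (Q₂₁ (hv v)) (0 : Matrix ρ₃ βc ℝ)) 0)
            (kkt (Gw₂ v v + G₂c v v + ((L * ΦF e * I).toBlocks₁₁ + ΨG e)) (fromRows (GY₂ v v) (0 : Matrix ρ₃ βc ℝ))) := by
    intro v e he
    have eG : ((((-((L * (H₁ v) - S * (fromRows (Q₁₁ (hv v)) (0 : Matrix ρ₂ β ℝ))) * Γ - L * (fromRows (Q₁₁ (hv v)) (0 : Matrix ρ₂ β ℝ))ᵀ * L) * (H₁ v) + L * (H₂ v v + ΦF e)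
          - (((L * (H₁ v) - S * (fromRows (Q₁₁ (hv v)) (0 : Matrix ρ₂ β ℝ))) * I + L * (fromRows (Q₁₁ (hv v)) (0 : Matrix ρ₂ β ℝ))ᵀ * S) * (fromRows (Q₁₁ (hv v)) (0 : Matrix ρ₂ β ℝ)) + S * (fromRows (Q₁₂ (hv v) (hv v)) (0 : Matrix ρ₂ β ℝ)))) * I
        + (L * (H₁ v) - S * (fromRows (Q₁₁ (hv v)) (0 : Matrix ρ₂ β ℝ))) * (-((Γ * (H₁ v) + I * (fromRows (Q₁₁ (hv v)) (0 : Matrix ρ₂ β ℝ))) * I + Γ * (fromRows (Q₁₁ (hv v)) (0 : Matrix ρ₂ β ℝ))ᵀ * S)))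
      - ((-((L * (H₁ v) - S * (fromRows (Q₁₁ (hv v)) (0 : Matrix ρ₂ β ℝ))) * Γ - L * (fromRows (Q₁₁ (hv v)) (0 : Matrix ρ₂ β ℝ))ᵀ * L) * (-(fromRows (Q₁₁ (hv v)) (0 : Matrix ρ₂ β ℝ))ᵀ) + L * (fromRows (Q₁₂ (hv v) (hv v)) (0 : Matrix ρ₂ β ℝ))ᵀ) * S
          + L * (-(fromRows (Q₁₁ (hv v)) (0 : Matrix ρ₂ β ℝ))ᵀ) * ((L * (H₁ v) - S * (fromRows (Q₁₁ (hv v)) (0 : Matrix ρ₂ β ℝ))) * I + L * (fromRows (Q₁₁ (hv v)) (0 : Matrix ρ₂ β ℝ))ᵀ * S)))).toBlocks₁₁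
          + G₂c v v + ΨG e
        = Gw₂ v v + G₂c v v + ((L * ΦF e * I).toBlocks₁₁ + ΨG e) := by
      rw [word_add_form Γ I L S, toBlocks₁₁_add', ← hGw₂]; abel
    rw [← eG]
    exact hdoor v e he
  -- (6) ONE call of #33
  exact mixedVar_kernel_law_of_directional_door N₀ (fun v => H'₁ v + ΛN v) 𝔔'₁ (fun v v' => H'₂ v v' + N₂c v v') NY₂ ΦN
    (lin_add H'₁ ΛN hH'₁l hΛN) h𝔔'₁l
    (fun c x y z => by simp only [hH'₂l, hN₂cl, smul_add]; abel) (fun c x y z => by simp only [hH'₂r, hN₂cr, smul_add]; abel)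
    hNY₂l hNY₂r hΦN
    F₀ H₁ (fun v => Q₁₁ (hv v)) H₂ (fun v v' => Q₁₂ (hv v) (hv v')) ΦF hH₁l hQ₁₁v hH₂l (fun c x y z => hH₂r c y z x) hQ₁₂l
      (fun c x y z => hQ₁₂r c y z x) hΦF
    G₀ (fun v => Gw₁ v + ΛG v) (fun v => Q₂₁ (hv v)) (fun v v' => Gw₂ v v' + G₂c v v') GY₂ (fun e => (L * ΦF e * I).toBlocks₁₁ + ΨG e)
    (lin_add Gw₁ ΛG hGw₁l hΛG) hQ₂₁v
    (fun c x y z => by simp only [hGw₂l, hG₂cl, smul_add]; abel) (fun c x y z => by simp only [hGw₂r, hG₂cr, smul_add]; abel)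
    hGY₂l hGY₂r
    (fun c x y => by rw [hΦF, hΨG, Matrix.mul_add, Matrix.mul_smul, Matrix.add_mul, Matrix.smul_mul, toBlocks₁₁_lin, smul_add]; abel)
    P hdoor' d E hEs hP k l

end Socket

end Summit.QuantumFields.BalabanUV.Beta.FP.LevelZeroDoorSocket

end
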